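import Literature.AlgebraicGeometry.Morphisms.CechH1
import Literature.AlgebraicGeometry.Modules.IndexedFrames
import Literature.AlgebraicGeometry.HodgeTheory.AtiyahClass
import HarnessLib

/-!
# Contracted `dlog`-cocycles span `Ȟ¹(𝔘, 𝒪)` when `φ` is injective and `h¹ ≤ rank Ω¹`

Generic Čech ∕ linear-algebra engine of «`φ_L : Lie(A) → H¹(A, 𝒪_A)` is onto for a non-degenerate line bundle on
an abelian variety in characteristic `0`» ([MumfordAV1970] §13, proof of the Theorem, pp. 125–130: `φ_L` is
injective on `Lie`, both sides have dimension `g`).  THEOREMS ONLY (no `def`, no instance, no `sorry`).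

Setting (the chart dialect of `Deformation/PairLiftObstructionMove`): a `k`-scheme `X`, opens `U : ι → Opens X`,
a module `L` with rank-one frames `F : IFrames L U` (transition units `g_{jl} = F.tf j l`,
`g_{jl}⁻¹ = F.tfOn l j _`), a GLOBAL frame `e : 𝒪^I ≅ Ω¹_{X/k}|_⊤` of the cotangent sheaf (`I` finite), and
global vector fields `D : Ω¹|_⊤ ⟶ 𝒪|_⊤`.  The *contracted `dlog`-cochain* of `D` is
`ω(D)_{jl} := g_{jl}⁻¹ · D(d g_{jl}) ∈ Γ(U_j ∩ U_l, 𝒪)`.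

* §1 `map_appLE_top`, `contractedDlog_cocycle` — `ω(D)` is a Čech `1`-cocycle (Leibniz + `g_{jl} g_{lm} = g_{jm}`);
* §2 `appLE_sum_smul_dualBasis`, `contractedDlog_sum_smul` — `ω(∑ sᵢ λᵢ) = ∑ sᵢ| ω(λᵢ)` for the dual basis `λᵢ`;
* §3 **`exists_eq_contractedDlog_add_of_injective_of_finrank_le`** — IF `D ↦ ω(D)` kills no non-zero global
  vector field modulo coboundaries (hypothesis `hinj`, the letter of (I2-a)) and `Ȟ¹(U, 𝒪_X)` is
  finite-dimensional over `k` of dimension `≤ #I` (the letter of (I2-B)), THEN every Čech `1`-cocycle `c` is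
  `ω(D) + (h_l| − h_j|)` for some global vector field `D` and `0`-cochain `h` (rank–nullity:
  `a ↦ [ω(∑ aᵢ λᵢ)]` is an injective `k`-linear map `k^I → Ȟ¹`, hence onto).

Consumer: (I2-C) `AbelianSchemes/PhiLOntoCharZero` (F-11 α1-(iii-c-2), cell hodgecm-mathlib), with `e` from ★
`Mumford1970_cotangentSheaf_abelianVariety_free_holds`.  HC_CM is proved only modulo the 7 printed citations until
rung 0 closes; this file is generic and asserts nothing about HC.

## References
* [MumfordAV1970] D. Mumford, *Abelian Varieties* (1970), §13, proof of the Theorem (pp. 125–130).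
* [Hartshorne1977] R. Hartshorne, *Algebraic Geometry* (1977), III §4 (Čech cohomology), II.8 (differentials).
* [StacksProject] The Stacks project, Tag 01ED (the Čech complex).
-/

noncomputable section

open CategoryTheory AlgebraicGeometry Opposite TopologicalSpace

universe u

namespace Literature.AlgebraicGeometry.Deformation

open Literature.AlgebraicGeometry.Modules Literature.AlgebraicGeometry.Motives
  Literature.AlgebraicGeometry.Morphisms Literature.AlgebraicGeometry.HodgeTheory

variable {k : Type u} [Field k] {X : Over (Spec (CommRingCat.of k))}
  {ι : Type u} (U : ι → X.left.Opens) {L : X.left.Modules} (F : IFrames L U)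

/-! ## §1 The contracted `dlog`-cochain is a cocycle -/

/-- Values of a global morphism `D : E|_⊤ → 𝒪|_⊤` commute with restriction:
`D(s)|_{V'} = D(s|_{V'})` (naturality of a morphism of sheaves of modules). [cite: Hartshorne1977, II §5 (p. 109)] -/
theorem map_appLE_top {E : X.left.Modules} (D : E.over ⊤ ⟶ (unitModule X.left).over ⊤)
    {V V' : X.left.Opens} (h : V' ≤ V) (s : Γ(E, V)) :
    X.left.presheaf.map (homOfLE h).op (show Γ(X.left, V) from appLE D (homOfLE le_top) s) =
      show Γ(X.left, V') from appLE D (homOfLE le_top) (E.presheaf.map (homOfLE h).op s) := by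
  have : (homOfLE (le_top : V' ≤ ⊤)) = homOfLE h ≫ homOfLE (le_top : V ≤ ⊤) := rfl
  rw [this, appLE_map]
  rfl

/-- `D(r • s) = r · D(s)` in `Γ(V, 𝒪)` (`𝒪_X(V)`-linearity of a morphism of `𝒪_X`-modules). [cite: Hartshorne1977, II §5 (p. 109)] -/
theorem appLE_top_smul {E : X.left.Modules} (D : E.over ⊤ ⟶ (unitModule X.left).over ⊤)
    {V : X.left.Opens} (r : Γ(X.left, V)) (s : Γ(E, V)) :
    (show Γ(X.left, V) from appLE D (homOfLE le_top) (r • s)) =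
      r * show Γ(X.left, V) from appLE D (homOfLE le_top) s := by
  rw [appLE_smul_right]
  rfl

/-- **The contracted `dlog`-cochain restricted to a smaller open**: for `V ≤ U_j ∩ U_l`,
`(g_{jl}⁻¹ · D(d g_{jl}))|_V = g_{jl}⁻¹|_V · D(d(g_{jl}|_V))` (`d` commutes with restriction). [cite: Hartshorne1977, II.8 Prop. 8.2A and p. 175] -/
theorem map_contractedDlog (D : (cotangentSheaf X).over ⊤ ⟶ (unitModule X.left).over ⊤) (j l : ι)
    {V : X.left.Opens} (hV : V ≤ U j ⊓ U l) :
    X.left.presheaf.map (homOfLE hV).op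
        (F.tfOn l j (U j ⊓ U l) inf_le_right inf_le_left *
          show Γ(X.left, U j ⊓ U l) from appLE D (homOfLE le_top) (dSection X (U j ⊓ U l) (F.tf j l))) =
      F.tfOn l j V (hV.trans inf_le_right) (hV.trans inf_le_left) *
        show Γ(X.left, V) from
          appLE D (homOfLE le_top) (dSection X V (F.tfOn j l V (hV.trans inf_le_left) (hV.trans inf_le_right))) := by
  rw [map_mul, IFrames.map_tfOn, map_appLE_top, map_dSection, F.tf_eq_tfOn, IFrames.map_tfOn]

/-- **The contracted `dlog`-cochain is a Čech `1`-cocycle**: on `U_j ∩ U_l ∩ U_m`,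
`ω_{jl}| + ω_{lm}| = ω_{jm}|` (shape of `Morphisms.cechD1` ∕ `IFrames.tf_cocycle`).  Leibniz
`d(g_{jl} g_{lm}) = g_{jl} dg_{lm} + g_{lm} dg_{jl}` and `g_{jl} g_{lm} = g_{jm}`: `dlog` is additive.
[cite: MumfordAV1970, §13 (p. 125)] [cite: Hartshorne1977, II.8 (p. 172)] -/
theorem contractedDlog_cocycle (D : (cotangentSheaf X).over ⊤ ⟶ (unitModule X.left).over ⊤) (j l m : ι) :
    X.left.presheaf.map (homOfLE (inf_le_left : U j ⊓ U l ⊓ U m ≤ U j ⊓ U l)).op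
        (F.tfOn l j (U j ⊓ U l) inf_le_right inf_le_left *
          show Γ(X.left, U j ⊓ U l) from appLE D (homOfLE le_top) (dSection X (U j ⊓ U l) (F.tf j l))) +
      X.left.presheaf.map (homOfLE (le_inf (inf_le_left.trans inf_le_right) inf_le_right :
          U j ⊓ U l ⊓ U m ≤ U l ⊓ U m)).op
        (F.tfOn m l (U l ⊓ U m) inf_le_right inf_le_left *
          show Γ(X.left, U l ⊓ U m) from appLE D (homOfLE le_top) (dSection X (U l ⊓ U m) (F.tf l m))) =
      X.left.presheaf.map (homOfLE (le_inf (inf_le_left.trans inf_le_left) inf_le_right :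
          U j ⊓ U l ⊓ U m ≤ U j ⊓ U m)).op
        (F.tfOn m j (U j ⊓ U m) inf_le_right inf_le_left *
          show Γ(X.left, U j ⊓ U m) from appLE D (homOfLE le_top) (dSection X (U j ⊓ U m) (F.tf j m))) := by
  rw [map_contractedDlog, map_contractedDlog, map_contractedDlog]
  set V : X.left.Opens := U j ⊓ U l ⊓ U m
  have hj : V ≤ U j := inf_le_left.trans inf_le_left
  have hl : V ≤ U l := inf_le_left.trans inf_le_right
  have hm : V ≤ U m := inf_le_right
  -- abbreviations
  set gjl := F.tfOn j l V hj hl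
  set glm := F.tfOn l m V hl hm
  set gilj := F.tfOn l j V hl hj
  set giml := F.tfOn m l V hm hl
  have hjm : F.tfOn j m V hj hm = gjl * glm := (F.tfOn_mul j l m V hj hl hm).symm
  have himj : F.tfOn m j V hm hj = giml * gilj := (F.tfOn_mul m l j V hm hl hj).symm
  have h1 : gilj * gjl = 1 := by rw [F.tfOn_mul l j l V hl hj hl, F.tfOn_self]
  have h2 : giml * glm = 1 := by rw [F.tfOn_mul m l m V hm hl hm, F.tfOn_self]
  rw [hjm, himj, dSection_mul, appLE_add_right]
  change _ = _ * ((show Γ(X.left, V) from appLE D (homOfLE le_top) (gjl • dSection X V glm)) +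
    show Γ(X.left, V) from appLE D (homOfLE le_top) (glm • dSection X V gjl))
  rw [appLE_top_smul, appLE_top_smul]
  set a := (show Γ(X.left, V) from appLE D (homOfLE le_top) (dSection X V gjl))
  set b := (show Γ(X.left, V) from appLE D (homOfLE le_top) (dSection X V glm))
  linear_combination (-(giml * b)) * h1 + (-(gilj * a)) * h2

/-! ## §2 The contracted `dlog`-cochain of a combination of the dual basis -/

section DualBasis

variable {I : Type u} [Fintype I] (e : SheafOfModules.free I ≅ (cotangentSheaf X).over ⊤)

/-- Values of `∑ᵢ sᵢ λᵢ`: `(∑ᵢ sᵢ λᵢ)(t) = ∑ᵢ sᵢ|_V · λᵢ(t)` (the `Γ(X, 𝒪_X)`-module structure of `Hom(E|_⊤, 𝒪|_⊤)`). [cite: Hartshorne1977, II §5 (pp. 109–110)] -/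
theorem appLE_sum_smul_top (s : I → Γ(X.left, ⊤)) (D : I → ((cotangentSheaf X).over ⊤ ⟶ (unitModule X.left).over ⊤))
    {V : X.left.Opens} (t : Γ(cotangentSheaf X, V)) :
    (show Γ(X.left, V) from appLE (∑ i, s i • D i) (homOfLE le_top) t) =
      ∑ i, X.left.presheaf.map (homOfLE (le_top : V ≤ ⊤)).op (s i) *
        show Γ(X.left, V) from appLE (D i) (homOfLE le_top) t := by
  rw [appLE_sum]
  change (∑ i, appLE (s i • D i) (homOfLE le_top) t : Γ(unitModule X.left, V)) = _
  refine Finset.sum_congr rfl fun i _ => ?_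
  rw [appLE_smul]
  rfl

/-- **`ω(∑ᵢ sᵢ λᵢ)_{jl} = ∑ᵢ sᵢ| · ω(λᵢ)_{jl}`**: the contracted `dlog`-cochain is `Γ(X, 𝒪_X)`-linear in the
vector field. [cite: Hartshorne1977, II §5 (pp. 109–110)] -/
theorem contractedDlog_sum_smul (s : I → Γ(X.left, ⊤))
    (D : I → ((cotangentSheaf X).over ⊤ ⟶ (unitModule X.left).over ⊤)) (j l : ι) :
    F.tfOn l j (U j ⊓ U l) inf_le_right inf_le_left *
        (show Γ(X.left, U j ⊓ U l) from
          appLE (∑ i, s i • D i) (homOfLE le_top) (dSection X (U j ⊓ U l) (F.tf j l))) =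
      ∑ i, X.left.presheaf.map (homOfLE (le_top : U j ⊓ U l ≤ ⊤)).op (s i) *
        (F.tfOn l j (U j ⊓ U l) inf_le_right inf_le_left *
          show Γ(X.left, U j ⊓ U l) from appLE (D i) (homOfLE le_top) (dSection X (U j ⊓ U l) (F.tf j l))) := by
  rw [appLE_sum_smul_top, Finset.mul_sum]
  exact Finset.sum_congr rfl fun i _ => by ring

/-- **The global vector field `∑ᵢ sᵢ λᵢ` evaluated on the basis form `bⱼ` is `sⱼ`** (`λᵢ(bⱼ) = δᵢⱼ`, the dual basis of a free module of finite rank). [cite: Hartshorne1977, II Ex. 5.1 (b) (p. 123)] -/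
theorem appLE_sum_smul_dualBasis_basisSection (s : I → Γ(X.left, ⊤)) (i₀ : I) :
    (show Γ(X.left, ⊤) from appLE (∑ i, s i • dualBasis e i) (𝟙 ⊤) (basisSection e i₀)) = s i₀ := by
  classical
  rw [appLE_sum]
  change (∑ i, appLE (s i • dualBasis e i) (𝟙 ⊤) (basisSection e i₀) : Γ(unitModule X.left, ⊤)) = _
  have h : ∀ i, (appLE (s i • dualBasis e i) (𝟙 ⊤) (basisSection e i₀) : Γ(unitModule X.left, ⊤)) =
      if i₀ = i then (show Γ(unitModule X.left, ⊤) from s i) else 0 := by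
    intro i
    rw [appLE_smul, appLE_dualBasis_basisSection, op_id, X.left.presheaf.map_id]
    change s i * _ = _
    split_ifs
    · exact mul_one _
    · exact mul_zero _
  simp_rw [h, Finset.sum_ite_eq, Finset.mem_univ, if_true]

end DualBasis

/-! ## §3 Rank–nullity: contracted `dlog`-cocycles span `Ȟ¹` -/

/-- If `Γ(X, 𝒪_X)` is trivial then so is every `Γ(W, 𝒪_X)` (restriction is a ring map, `1|_W = 1`, `0|_W = 0`). [cite: Hartshorne1977, II §2 (p. 72, restriction homomorphisms of the structure sheaf)] -/
theorem subsingleton_sections_of_subsingleton_top [Subsingleton Γ(X.left, ⊤)] (W : X.left.Opens) :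
    Subsingleton Γ(X.left, W) := by
  refine subsingleton_of_zero_eq_one ?_
  rw [← map_zero (X.left.presheaf.map (homOfLE (le_top : W ≤ ⊤)).op).hom,
    ← map_one (X.left.presheaf.map (homOfLE (le_top : W ≤ ⊤)).op).hom, Subsingleton.elim (0 : Γ(X.left, ⊤)) 1]

/-- **CONTRACTED `dlog`-COCYCLES SPAN `Ȟ¹(𝔘, 𝒪_X)`** ([MumfordAV1970] §13, the dimension count in the proof of
the Theorem).  Let `e : 𝒪^I ≅ Ω¹_{X/k}|_⊤` be a global frame (`I` finite) and `F` rank-one frames of `L` on the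
opens `U` with transition units `g_{jl}`.  Suppose (a) INJECTIVITY: a global vector field `D` whose contracted
`dlog`-cochain `g_{jl}⁻¹ D(dg_{jl})` is a Čech coboundary vanishes; (b) `Ȟ¹(U, 𝒪_X)` is finite-dimensional over
`k` of dimension `≤ #I`.  Then EVERY Čech `1`-cocycle `c` of `𝒪_X` on `U` is a contracted `dlog`-cocycle up to a
coboundary: `∃ D h, ∀ j l, c_{jl} = g_{jl}⁻¹ D(dg_{jl}) + (h_l| − h_j|)`.  Proof: `a ↦ [ω(∑ᵢ aᵢ λᵢ)]` is a
`k`-linear map `k^I → Ȟ¹(U, 𝒪_X)`, injective by (a) (and `λᵢ(bⱼ) = δᵢⱼ`, `k → Γ(X, 𝒪_X)` injective), hence onto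
by (b). [cite: MumfordAV1970, §13, proof of the Theorem (pp. 125–130)] [cite: Hartshorne1977, III §4 (p. 218)] -/
theorem exists_eq_contractedDlog_add_of_injective_of_finrank_le
    {I : Type u} [Fintype I] (e : SheafOfModules.free I ≅ (cotangentSheaf X).over ⊤)
    (hinj : ∀ (D : (cotangentSheaf X).over ⊤ ⟶ (unitModule X.left).over ⊤) (h : (j : ι) → Γ(X.left, U j)),
      (∀ j l : ι, F.tfOn l j (U j ⊓ U l) inf_le_right inf_le_left *
            (show Γ(X.left, U j ⊓ U l) from
              appLE D (homOfLE le_top) (dSection X (U j ⊓ U l) (F.tf j l))) =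
          X.left.presheaf.map (homOfLE (inf_le_right : U j ⊓ U l ≤ U l)).op (h l) -
            X.left.presheaf.map (homOfLE (inf_le_left : U j ⊓ U l ≤ U j)).op (h j)) → D = 0)
    [Module.Finite k (CechH1 X.hom U)] (hle : Module.finrank k (CechH1 X.hom U) ≤ Fintype.card I)
    (c : (j l : ι) → Γ(X.left, U j ⊓ U l))
    (hc : ∀ j l m : ι,
      X.left.presheaf.map (homOfLE (inf_le_left : U j ⊓ U l ⊓ U m ≤ U j ⊓ U l)).op (c j l) +
          X.left.presheaf.map (homOfLE (le_inf (inf_le_left.trans inf_le_right) inf_le_right :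
            U j ⊓ U l ⊓ U m ≤ U l ⊓ U m)).op (c l m) =
        X.left.presheaf.map (homOfLE (le_inf (inf_le_left.trans inf_le_left) inf_le_right :
          U j ⊓ U l ⊓ U m ≤ U j ⊓ U m)).op (c j m)) :
    ∃ (D : (cotangentSheaf X).over ⊤ ⟶ (unitModule X.left).over ⊤) (h : (j : ι) → Γ(X.left, U j)),
      ∀ j l : ι, c j l =
        F.tfOn l j (U j ⊓ U l) inf_le_right inf_le_left *
            (show Γ(X.left, U j ⊓ U l) from
              appLE D (homOfLE le_top) (dSection X (U j ⊓ U l) (F.tf j l))) +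
          (X.left.presheaf.map (homOfLE (inf_le_right : U j ⊓ U l ≤ U l)).op (h l) -
            X.left.presheaf.map (homOfLE (inf_le_left : U j ⊓ U l ≤ U j)).op (h j)) := by
  classical
  -- the degenerate case `Γ(X, 𝒪_X) = 0`
  rcases subsingleton_or_nontrivial Γ(X.left, ⊤) with h0 | h0
  · refine ⟨0, fun _ => 0, fun j l => ?_⟩
    haveI := subsingleton_sections_of_subsingleton_top (X := X) (U j ⊓ U l)
    exact Subsingleton.elim _ _
  -- notation: the contracted `dlog`-cochain of a vector field, as a Čech `1`-cochain
  let ω : ((cotangentSheaf X).over ⊤ ⟶ (unitModule X.left).over ⊤) → CechC1 X.hom U := fun D j l =>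
    show Γ(X.left, U j ⊓ U l) from
      F.tfOn l j (U j ⊓ U l) inf_le_right inf_le_left *
        (show Γ(X.left, U j ⊓ U l) from appLE D (homOfLE le_top) (dSection X (U j ⊓ U l) (F.tf j l)))
  have hω : ∀ D, ω D ∈ cechZ1 X.hom U := fun D => by
    rw [mem_cechZ1_iff]
    funext j l m
    rw [cechD1_apply, Sections.res_apply, Sections.res_apply, Sections.res_apply]
    change _ - _ + _ = (0 : Γ(X.left, U j ⊓ U l ⊓ U m))
    rw [sub_add_eq_add_sub, sub_eq_zero, add_comm]
    exact contractedDlog_cocycle U F D j l m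
  -- the vector fields `D a := ∑ aᵢ λᵢ` and the linear map `Φ a := [ω(D a)]`
  let σ : k →+* Γ(X.left, ⊤) := algebraMapΓ X.hom
  let Dv : (I → k) → ((cotangentSheaf X).over ⊤ ⟶ (unitModule X.left).over ⊤) := fun a =>
    ∑ i, σ (a i) • dualBasis e i
  let z : I → ↥(cechZ1 X.hom U) := fun i => ⟨ω (dualBasis e i), hω _⟩
  let Φ : (I → k) →ₗ[k] CechH1 X.hom U :=
    ∑ i, (LinearMap.proj i : (I → k) →ₗ[k] k).smulRight (CechH1.mk X.hom U (z i))
  have hΦ : ∀ a, Φ a = CechH1.mk X.hom U (∑ i, a i • z i) := fun a => by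
    simp only [Φ, LinearMap.coe_sum, Finset.sum_apply, LinearMap.smulRight_apply, LinearMap.proj_apply,
      map_sum, map_smul]
  -- the bridge: the cochain of `∑ aᵢ zᵢ` is `ω(D a)`
  have hbridge : ∀ (a : I → k) (j l : ι), ((∑ i, a i • z i : ↥(cechZ1 X.hom U)) : CechC1 X.hom U) j l = ω (Dv a) j l := by
    intro a j l
    rw [Submodule.coe_sum, Finset.sum_apply, Finset.sum_apply]
    change ∑ i, ((a i • z i : ↥(cechZ1 X.hom U)) : CechC1 X.hom U) j l = _
    simp_rw [Submodule.coe_smul, Pi.smul_apply, Algebra.smul_def, Sections.algebraMap_apply]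
    exact (contractedDlog_sum_smul U F (fun i => σ (a i)) (fun i => dualBasis e i) j l).symm
  -- `Φ` is injective
  have hΦinj : Function.Injective Φ := by
    rw [injective_iff_map_eq_zero]
    intro a ha
    rw [hΦ, CechH1.mk_eq_zero_iff, mem_cechB1_iff] at ha
    obtain ⟨b, hb⟩ := ha
    have hD : Dv a = 0 := by
      refine hinj (Dv a) (fun j => b j) fun j l => ?_
      have := congrFun (congrFun hb j) l
      rw [cechD0_apply, Sections.res_apply, Sections.res_apply, hbridge] at this
      exact this.symm
    funext i₀
    have h1 : (show Γ(X.left, ⊤) from appLE (Dv a) (𝟙 ⊤) (basisSection e i₀)) = σ (a i₀) :=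
      appLE_sum_smul_dualBasis_basisSection e (fun i => σ (a i)) i₀
    rw [hD, appLE_zero] at h1
    exact σ.injective (h1.symm.trans (map_zero σ).symm)
  -- hence onto, by the dimension count
  have hΦsurj : Function.Surjective Φ := by
    have hr : Module.finrank k (LinearMap.range Φ) = Fintype.card I := by
      rw [LinearMap.finrank_range_of_inj hΦinj, Module.finrank_fintype_fun_eq_card]
    have htop : LinearMap.range Φ = ⊤ :=
      Submodule.eq_top_of_finrank_eq (le_antisymm (Submodule.finrank_le _) (hr ▸ hle))
    exact LinearMap.range_eq_top.1 htop
  -- read off the cocycle `c`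
  let zc : ↥(cechZ1 X.hom U) := ⟨fun j l => show Γ(X.left, U j ⊓ U l) from c j l, by
    rw [mem_cechZ1_iff]
    funext j l m
    rw [cechD1_apply, Sections.res_apply, Sections.res_apply, Sections.res_apply]
    change _ - _ + _ = (0 : Γ(X.left, U j ⊓ U l ⊓ U m))
    rw [sub_add_eq_add_sub, sub_eq_zero, add_comm]
    exact hc j l m⟩
  obtain ⟨a, ha⟩ := hΦsurj (CechH1.mk X.hom U zc)
  rw [hΦ] at ha
  have hsub : CechH1.mk X.hom U (zc - ∑ i, a i • z i) = 0 := by rw [map_sub, sub_eq_zero, ha]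
  rw [CechH1.mk_eq_zero_iff, mem_cechB1_iff] at hsub
  obtain ⟨b, hb⟩ := hsub
  refine ⟨Dv a, fun j => b j, fun j l => ?_⟩
  have := congrFun (congrFun hb j) l
  rw [cechD0_apply, Sections.res_apply, Sections.res_apply, Submodule.coe_sub, Pi.sub_apply, Pi.sub_apply,
    hbridge] at this
  have key : X.left.presheaf.map (homOfLE (inf_le_right : U j ⊓ U l ≤ U l)).op (b l) -
      X.left.presheaf.map (homOfLE (inf_le_left : U j ⊓ U l ≤ U j)).op (b j) =
      c j l - F.tfOn l j (U j ⊓ U l) inf_le_right inf_le_left *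
          (show Γ(X.left, U j ⊓ U l) from
            appLE (Dv a) (homOfLE le_top) (dSection X (U j ⊓ U l) (F.tf j l))) := this
  linear_combination -key

end Literature.AlgebraicGeometry.Deformation

end
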